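import Summits.Ventures.Crystal3D.Theorems.StickyWulffConstantCoaxialWallLawTailResidueDefsM
import Summits.Ventures.Crystal3D.Theorems.StickyWulffConstantCoaxialWallLawOnSiteBridge
import HarnessLib

/-!
# `ModuleCapture`, SHALLOW CASE: a mono-module window whose transported frame is standard is captured (crux `CoaxialWallLaw`, stmt-Ventures-19481)

HONEST FRAMING. Venture `Summits/Ventures/Crystal3D` (cell `crystal3d-full`); helper `--supports` the crux `CoaxialWallLaw`
(stmt-Ventures-19481, `route-Ventures-StickyWulffConstant`), registered line 'CoaxialWallLawCertificates' (planner cf-p1).  Census-free;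
F-C1 not moved.  Towards `TailResidue.ModuleCapture` (…TailResidueDefsM, cf-p1 (cxxxii)): `MonoModuleAt ⇒ CapturedAt`.  This file does the
POSITION BOOKKEEPING once and for all and closes the case in which the transported plate frame `L̃ = L.trans S.symm` is itself standard
(`L₀ := L̃`, same classes on both sides — no class collapse needed):
* `mem_exactOf_iff` (`exactOf Y = Y ∩ exactPos`), `exists_slot_neg_of_adm` (the predecessor `q − d` is a dozen position `q + G w`);
* `isFull_of_exact`, `isNarrow_of_exact`, `isTwinReading_of_exact` (readings DESCEND to the exact part when the read balls are exact),
  `isMoving_of_subset` (movers LIFT from the exact part when the far-slot balls are exact), **`isEndMove_of_exact`** (`IsEndMove` descends when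
  the target and every `InspectedAt` ball are exact — the cross frame `G ≫ R_m` reads the mirrored dozen `G w − 2⟪G w, m⟫ m`);
* **`capturedAt_of_mono_of_stdFrame`**, `moduleCapture_shallow` — `StdFrame L̃` + the `MonoModuleAt` clause for `S` ⇒ `CapturedAt L X z`.
The DEEP case (`L̃` not standard: the generalized class collapse «standard-dozen classes of a deep frame's joint systems near one payer are
classes of ONE standard placement») is the remaining content of `ModuleCapture`; finite-check evidence HOME/wall-19481-p2/g10-calc/gcc_check.py
(516 deep frames × 384 placements, 0 failures).
WHAT THIS IS NOT: not `ModuleCapture`; F-C1 not moved.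
-/

noncomputable section

-- the window Finsets (`siteBall`, `apexBall`) are large closed terms; unification around them needs a deeper recursion budget
set_option maxRecDepth 65536

namespace Summit.Ventures.Crystal3D.Theorems

namespace TailResidue

open Summit.Ventures.Crystal3D Finset
open scoped InnerProductSpace

/-! ### Exact positions -/

/-- **Exact balls are the window balls at exact positions.** -/
theorem mem_exactOf_iff {Y : Finset (EuclideanSpace ℝ (Fin 3))} {x : EuclideanSpace ℝ (Fin 3)} :
    x ∈ exactOf Y ↔ x ∈ Y ∧ x ∈ exactPos := by
  classical
  unfold exactOf exactPos occOf apexOf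
  simp only [Finset.mem_union, Finset.mem_image, Finset.mem_filter, Set.mem_union, Set.mem_image, Finset.mem_coe]
  constructor
  · rintro (⟨s, ⟨hs, hsX⟩, rfl⟩ | ⟨F, ⟨hF, hFX⟩, rfl⟩)
    · exact ⟨hsX, Or.inl ⟨s, hs, rfl⟩⟩
    · exact ⟨hFX, Or.inr ⟨F, hF, rfl⟩⟩
  · rintro ⟨hx, ⟨s, hs, rfl⟩ | ⟨F, hF, rfl⟩⟩
    · exact Or.inl ⟨s, ⟨hs, hx⟩, rfl⟩
    · exact Or.inr ⟨F, ⟨hF, hx⟩, rfl⟩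

/-- The direction of an admissible class of a basal system is the image of a slot whose negative is a slot: `−d = G w`. -/
theorem exists_slot_neg_of_adm {L G : EuclideanSpace ℝ (Fin 3) ≃ₗᵢ[ℝ] EuclideanSpace ℝ (Fin 3)} {d : EuclideanSpace ℝ (Fin 3)}
    (h : (basalSystem L).Adm G d) : ∃ w ∈ fccSlots, -d = G w := by
  obtain ⟨r, hr, κ, -, hG, hd⟩ := h
  have hr' : r ∈ fccSlots := (Finset.mem_filter.1 hr).1
  rcases neg_one_pow_eq_or ℝ κ.length with h1 | h1
  · refine ⟨-r, neg_mem_fccSlots hr', ?_⟩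
    rw [hd, hG, h1, one_smul, map_neg]
  · refine ⟨r, hr', ?_⟩
    rw [hd, hG, h1, neg_smul, one_smul, map_neg, neg_neg]

/-! ### Monotonicity of the automaton predicates under «inspected balls are exact» -/

section Mono

variable {Y E : Finset (EuclideanSpace ℝ (Fin 3))} (hEY : E ⊆ Y)
  {G : EuclideanSpace ℝ (Fin 3) ≃ₗᵢ[ℝ] EuclideanSpace ℝ (Fin 3)} {q b d : EuclideanSpace ℝ (Fin 3)} {v : WordVersion}

/-- `IsFull` descends to the exact part when the read balls are exact. -/
theorem isFull_of_exact (h : IsFull Y G q) (hs : ∀ w ∈ fccSlots, q + G w ∈ Y → q + G w ∈ E) : IsFull E G q :=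
  fun w hw => hs w hw (h w hw)

/-- `IsNarrow` descends. -/
theorem isNarrow_of_exact (h : IsNarrow Y G d q) (hs : ∀ w ∈ fccSlots, q + G w ∈ Y → q + G w ∈ E) (hd : q + d ∈ Y → q + d ∈ E) :
    IsNarrow E G d q := by
  obtain ⟨hqd, m, hm, hdm, htr⟩ := h
  exact ⟨hd hqd, m, hm, hdm, fun w hw hpos => hs w hw (htr w hw hpos)⟩

include hEY in
/-- `IsTwinReading` descends (far slots stay empty in the smaller configuration). -/
theorem isTwinReading_of_exact {m : EuclideanSpace ℝ (Fin 3)} (h : IsTwinReading Y G m q)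
    (hs : ∀ w ∈ fccSlots, q + G w ∈ Y → q + G w ∈ E)
    (hmir : ∀ w ∈ fccSlots, q + (G w - (2 * ⟪G w, m⟫_ℝ) • m) ∈ Y → q + (G w - (2 * ⟪G w, m⟫_ℝ) • m) ∈ E) :
    IsTwinReading E G m q := by
  obtain ⟨hmn, hlow, hmr, hfar⟩ := h
  exact ⟨hmn, fun w hw hle => hs w hw (hlow w hw hle), fun w hw hlt => hmir w hw (hmr w hw hlt),
    fun w hw hpos hmem => hfar w hw hpos (hEY hmem)⟩

include hEY in
/-- `IsMoving` LIFTS from the exact part when the far-slot balls of `b` are exact. -/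
theorem isMoving_of_subset {G' : EuclideanSpace ℝ (Fin 3) ≃ₗᵢ[ℝ] EuclideanSpace ℝ (Fin 3)} {d' : EuclideanSpace ℝ (Fin 3)}
    (hfar : ∀ w ∈ fccSlots, b + G' w ∈ Y → b + G' w ∈ E) (h : IsMoving E v G' d' b) : IsMoving Y v G' d' b := by
  rcases h with hf | ⟨m, ⟨hmn, hlow, hmr, hfr⟩, hdm⟩ | ⟨hv, hqd, m, hm, hdm, htr⟩
  · exact Or.inl fun w hw => hEY (hf w hw)
  · refine Or.inr (Or.inl ⟨m, ⟨hmn, fun w hw hle => hEY (hlow w hw hle), fun w hw hlt => hEY (hmr w hw hlt),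
      fun w hw hpos hmem => hfr w hw hpos (hfar w hw hmem)⟩, hdm⟩)
  · exact Or.inr (Or.inr ⟨hv, hEY hqd, m, hm, hdm, fun w hw hpos => hEY (htr w hw hpos)⟩)

include hEY in
/-- **`IsEndMove` descends to the exact part** when the target is exact and every inspected ball (dozen and mirrored-dozen positions of `q`
and of `b`) is exact. -/
theorem isEndMove_of_exact (h : IsEndMove Y v G d q b) (hbE : b ∈ E) (hins : ∀ x ∈ Y, InspectedAt G q b x → x ∈ E) :
    IsEndMove E v G d q b := by
  have hsq : ∀ w ∈ fccSlots, q + G w ∈ Y → q + G w ∈ E := fun w hw hmem => hins _ hmem ⟨w, hw, Or.inl rfl⟩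
  have hsb : ∀ w ∈ fccSlots, b + G w ∈ Y → b + G w ∈ E := fun w hw hmem => hins _ hmem ⟨w, hw, Or.inr (Or.inl rfl)⟩
  have hmq : ∀ m, IsMenuNormal G m → ∀ w ∈ fccSlots, q + (G w - (2 * ⟪G w, m⟫_ℝ) • m) ∈ Y → q + (G w - (2 * ⟪G w, m⟫_ℝ) • m) ∈ E :=
    fun m hm w hw hmem => hins _ hmem ⟨w, hw, Or.inr (Or.inr ⟨m, hm, Or.inl rfl⟩)⟩
  have hmb : ∀ m, IsMenuNormal G m → ∀ w ∈ fccSlots, b + (G w - (2 * ⟪G w, m⟫_ℝ) • m) ∈ Y → b + (G w - (2 * ⟪G w, m⟫_ℝ) • m) ∈ E :=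
    fun m hm w hw hmem => hins _ hmem ⟨w, hw, Or.inr (Or.inr ⟨m, hm, Or.inr rfl⟩)⟩
  rcases h with ⟨hrd, hb, hnm⟩ | ⟨m, htw, hdm, hb, hnm⟩
  · refine Or.inl ⟨?_, hb, fun hmov => hnm (isMoving_of_subset hEY hsb hmov)⟩
    rcases hrd with hf | ⟨hv, hn⟩ | ⟨m, htw, hdm⟩
    · exact Or.inl (isFull_of_exact hf hsq)
    · exact Or.inr (Or.inl ⟨hv, isNarrow_of_exact hn hsq fun _ => by rw [← hb]; exact hbE⟩)
    · exact Or.inr (Or.inr ⟨m, isTwinReading_of_exact hEY htw hsq (hmq m htw.1), hdm⟩)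
  · refine Or.inr ⟨m, isTwinReading_of_exact hEY htw hsq (hmq m htw.1), hdm, hb, fun hmov => hnm (isMoving_of_subset hEY ?_ hmov)⟩
    intro w hw hmem
    have hm1 : ‖m‖ = 1 := htw.1.1
    have e : (G.trans (ℝ ∙ m)ᗮ.reflection) w = G w - (2 * ⟪G w, m⟫_ℝ) • m := by
      rw [LinearIsometryEquiv.trans_apply, reflection_unit_apply hm1]
    rw [e] at hmem ⊢
    exact hmb m htw.1 w hw hmem

end Mono

/-! ### The shallow case of `ModuleCapture`: the window's frame is itself standard -/

/-- **SHALLOW MODULE CAPTURE.**  If a placement `S` makes the window mono-module (the clause of `MonoModuleAt`) AND the transported frame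
`L̃ = L.trans S.symm` is standard, the window is captured with `L₀ := L̃`: every (A)-end pair near the payer is a flat end pair of the exact part for
the SAME classes (no class collapse needed).  The deep case (`L̃` not standard) is the generalized class collapse. -/
theorem capturedAt_of_mono_of_stdFrame {L : EuclideanSpace ℝ (Fin 3) ≃ₗᵢ[ℝ] EuclideanSpace ℝ (Fin 3)} {X : Finset (EuclideanSpace ℝ (Fin 3))}
    {z : EuclideanSpace ℝ (Fin 3)} (S : EuclideanSpace ℝ (Fin 3) ≃ₗᵢ[ℝ] EuclideanSpace ℝ (Fin 3)) (hstd : StdFrame (L.trans S.symm))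
    (hmono : ∀ b q : EuclideanSpace ℝ (Fin 3), ∀ G : EuclideanSpace ℝ (Fin 3) ≃ₗᵢ[ℝ] EuclideanSpace ℝ (Fin 3), ∀ d : EuclideanSpace ℝ (Fin 3),
      dist (0 : EuclideanSpace ℝ (Fin 3)) b ≤ 1 → q ∈ shifted S z X → b ∈ shifted S z X →
      ((basalSystem (L.trans S.symm)).Adm G d ∨
        (basalSystem (((ℝ ∙ EuclideanSpace.single (2 : Fin 3) (1 : ℝ)).reflection).trans (L.trans S.symm))).Adm G d) →
      q - d ∈ shifted S z X → IsEndMove (shifted S z X) WordVersion.v2 G d q b →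
        q ∈ exactPos ∧ b ∈ exactPos ∧ ∀ x ∈ shifted S z X, InspectedAt G q b x → x ∈ exactPos) :
    CapturedAt L X z := by
  refine ⟨S, L.trans S.symm, hstd, fun b q hb hpair => ?_⟩
  obtain ⟨hq, hbY, -, G, d, hadm, hqd, hmove⟩ := hpair
  obtain ⟨hqE, hbE, hins⟩ := hmono b q G d hb hq hbY hadm hqd hmove
  have hqE' : q ∈ exactOf (shifted S z X) := mem_exactOf_iff.2 ⟨hq, hqE⟩
  have hbE' : b ∈ exactOf (shifted S z X) := mem_exactOf_iff.2 ⟨hbY, hbE⟩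
  have hins' : ∀ x ∈ shifted S z X, InspectedAt G q b x → x ∈ exactOf (shifted S z X) :=
    fun x hx hi => mem_exactOf_iff.2 ⟨hx, hins x hx hi⟩
  -- the predecessor is inspected: `q − d = q + G w` with `w` a slot
  have hadm' : ∃ w ∈ fccSlots, -d = G w := by
    rcases hadm with h | h
    · exact exists_slot_neg_of_adm h
    · exact exists_slot_neg_of_adm h
  obtain ⟨w, hw, hdw⟩ := hadm'
  have hqdE : q - d ∈ exactOf (shifted S z X) := by
    have e : q - d = q + G w := by rw [sub_eq_add_neg, hdw]
    rw [e] at hqd ⊢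
    exact hins' _ hqd ⟨w, hw, Or.inl rfl⟩
  exact ⟨hqE', hbE', G, d, hadm, hqdE, isEndMove_of_exact (exactOf_subset _) hmove hbE' hins'⟩

/-- **`ModuleCapture` in the shallow case, packaged**: an off-site payer window with a mono-module placement whose frame is standard is captured. -/
theorem moduleCapture_shallow {L : EuclideanSpace ℝ (Fin 3) ≃ₗᵢ[ℝ] EuclideanSpace ℝ (Fin 3)} {X : Finset (EuclideanSpace ℝ (Fin 3))}
    {z : EuclideanSpace ℝ (Fin 3)}
    (h : ∃ S : EuclideanSpace ℝ (Fin 3) ≃ₗᵢ[ℝ] EuclideanSpace ℝ (Fin 3), StdFrame (L.trans S.symm) ∧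
      ∀ b q : EuclideanSpace ℝ (Fin 3), ∀ G : EuclideanSpace ℝ (Fin 3) ≃ₗᵢ[ℝ] EuclideanSpace ℝ (Fin 3), ∀ d : EuclideanSpace ℝ (Fin 3),
      dist (0 : EuclideanSpace ℝ (Fin 3)) b ≤ 1 → q ∈ shifted S z X → b ∈ shifted S z X →
      ((basalSystem (L.trans S.symm)).Adm G d ∨
        (basalSystem (((ℝ ∙ EuclideanSpace.single (2 : Fin 3) (1 : ℝ)).reflection).trans (L.trans S.symm))).Adm G d) →
      q - d ∈ shifted S z X → IsEndMove (shifted S z X) WordVersion.v2 G d q b →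
        q ∈ exactPos ∧ b ∈ exactPos ∧ ∀ x ∈ shifted S z X, InspectedAt G q b x → x ∈ exactPos) :
    CapturedAt L X z := by
  obtain ⟨S, hstd, hmono⟩ := h
  exact capturedAt_of_mono_of_stdFrame S hstd hmono

end TailResidue

end Summit.Ventures.Crystal3D.Theorems

end
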